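import Literature.Probability.Percolation.SlabRSWGluingRoute
import HarnessLib

/-!
# Newman–Tassion–Wu 2017, Theorem 3.10 — routes in a clipped corner box when the port sits under a
# corner cell carrying an end of the minimal path

Topic: `Literature/Probability/Percolation`. Sixteenth file of the port of THEOREM 3.10 of
Newman–Tassion–Wu, *Critical percolation and the minimal spanning tree in slabs* (CPAM 70 (2017);
arXiv:1512.09107, pp. 12–14). In the corner gluings of Theorem 3.10 the cleared set must lie inside
the corner square (every edge off it may carry a bystander event), so the cleared box
`D = [xL,xR] × [rB,rT]` is the corner square clipped to a ball around the contact cell, and the port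
may sit directly under a CORNER cell `Z` of `D` that also carries the first or last vertex of
`Γ_min` over `D` — a planar coincidence excluded by the hypotheses of the tree's routing theorem
`exists_route` (DST 2016, Fact 2: three disjoint paths). This file supplies the routes (`RouteSpec`)
for those residual configurations, by routing in the sub-box without the corner column and moving
the three terminals into it along one or two lattice steps (`RouteSpec.cons_trunk`,
`concat_trunk`, `concat_branch`):

* bottom-left corner `Z = (xL, rB)`: `route_cornerBL_fst` (`E₁` over `Z`), `route_cornerBL_fst'`
  (`E₁` over `Z`, `E₂` just above it at the same height), `route_cornerBL_snd`, `route_cornerBL_snd'`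
  (the same for `E₂`), `route_cornerBL_both` (`E₁, E₂` and the branch end all over `Z`);
* bottom-right corner `Z = (xR, rB)`: `route_cornerBR_snd` (`E₂` over `Z`; `E₁` inside the
  sub-box or at the top-right cell of `D`).

## Sources

* C. M. Newman, V. Tassion, W. Wu, *Critical percolation and the minimal spanning tree in slabs*,
  Comm. Pure Appl. Math. 70 (2017), arXiv:1512.09107: §3.2, proof of Theorem 3.7, steps (1)–(3)
  (the rerouting), applied in the proof of Theorem 3.10, (3.121)–(3.122) [NewmanTassionWu2017].
* H. Duminil-Copin, V. Sidoravicius, V. Tassion, CPAM 69 (2016), §2.3, proof of Fact 2 (the three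
  disjoint paths; the tree's `exists_route`) [DuminilCopinSidoraviciusTassion2016].
-/

noncomputable section

namespace Literature.Probability.Percolation

open LatticeModels SimpleGraph

namespace NTW17

variable {k : ℕ}

/-! ## Small helpers -/

/-- `(a, b) ∼ (a+1, b)`. [folklore] -/
private theorem padj_r (a b : ℤ) : planarAdj (a, b) (a + 1, b) := Or.inl (Or.inl (by ext <;> simp))
/-- `(a+1, b) ∼ (a, b)`. [folklore] -/
private theorem padj_l (a b : ℤ) : planarAdj (a + 1, b) (a, b) := Or.inl (Or.inr (by ext <;> simp))
/-- `(a, b) ∼ (a, b+1)`. [folklore] -/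
private theorem padj_u (a b : ℤ) : planarAdj (a, b) (a, b + 1) := Or.inr (Or.inl (by ext <;> simp))
/-- `(a, b+1) ∼ (a, b)`. [folklore] -/
private theorem padj_d (a b : ℤ) : planarAdj (a, b + 1) (a, b) := Or.inr (Or.inr (by ext <;> simp))

/-- Vertices of equal height over adjacent cells are adjacent. [folklore] -/
private theorem adj_of_cells {v w : slab 3 k} (hh : ht v = ht w)
    (hp : planarAdj (planar k v) (planar k w)) : (slabGraph 3 k).Adj v w :=
  (slab_adj_iff v w).2 (Or.inl ⟨hh, hp⟩)

/-- Planar part of `vtx z (ht v)`. [folklore] -/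
private theorem planar_vtx_ht (z : ℤ × ℤ) (v : slab 3 k) : planar k (vtx k z (ht v)) = z := planar_vtx z _

/-- Height of `vtx z (ht v)`. [folklore] -/
private theorem ht_vtx_ht (z : ℤ × ℤ) (v : slab 3 k) : ht (vtx k z (ht v)) = ht v := ht_vtx (ht_le v) z

/-- Vertices over different cells differ. [folklore] -/
private theorem ne_of_planar_ne {v w : slab 3 k} (h : planar k v ≠ planar k w) : v ≠ w :=
  fun hvw => h (by rw [hvw])

/-- A vertex outside the columns of a region is not on a list over it. [folklore] -/
private theorem not_mem_of_not_mem_region {L : List (slab 3 k)} {R : Set (ℤ × ℤ)}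
    (hL : ∀ v ∈ L, planar k v ∈ R) {v : slab 3 k} (hv : planar k v ∉ R) : v ∉ L :=
  fun h => hv (hL v h)

/-! ## The bottom-left corner -/

section BottomLeft

variable {xL xR rB rT : ℤ}

/-- The sub-box without the left column sits inside the box. [folklore] -/
private theorem sub_left (xL xR rB rT : ℤ) : boxR (xL + 1) xR rB rT ⊆ boxR xL xR rB rT := by
  intro z hz; rw [mem_boxR_iff] at hz ⊢; omega

/-- **Bottom-left corner, `E₁` over the corner cell.** `D = [xL,xR]×[rB,rT]` (at least `4 × 4`),
`E₁` and the branch end `x ≠ E₁` over `Z = (xL, rB)`, `E₂` over `D` off the cells `Z`, `(xL+1, rB)`,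
`(xL+1, rB+1)`, different from `x` and from the vertex above `E₁`: a route exists (trunk
`E₁ → (xL,rB+1) → (xL+1,rB+1) ⇝ E₂`, branch `⇝ (xL+1,rB) → x`, the middle pieces by `exists_route`
in `[xL+1,xR]×[rB,rT]`). [cite: NewmanTassionWu2017, §3.2 (proof of Theorem 3.7, steps (1)–(3))] -/
theorem route_cornerBL_fst (hk : 1 ≤ k) (hcols : xL + 3 ≤ xR) (hrows : rB + 3 ≤ rT)
    {E₁ E₂ x : slab 3 k} (hE₁ : planar k E₁ = (xL, rB)) (hx : planar k x = (xL, rB)) (hE₁x : E₁ ≠ x)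
    (hE₂D : planar k E₂ ∈ boxR xL xR rB rT) (hE₂a : planar k E₂ ≠ (xL, rB))
    (hE₂b : planar k E₂ ≠ (xL + 1, rB)) (hE₂c : planar k E₂ ≠ (xL + 1, rB + 1))
    (hE₂d : E₂ ≠ vtx k (xL, rB + 1) (ht E₁)) (hE₂x : E₂ ≠ x) :
    ∃ L Br c, RouteSpec k (boxR xL xR rB rT) (boxR xL xR rB rT) E₁ E₂ x L Br c := by
  set D := boxR xL xR rB rT with hD
  set T := boxR (xL + 1) xR rB rT with hT
  have hTD : T ⊆ D := sub_left xL xR rB rT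
  set m₁ : slab 3 k := vtx k (xL, rB + 1) (ht E₁) with hm₁
  set E₁' : slab 3 k := vtx k (xL + 1, rB + 1) (ht E₁) with hE₁'
  set w'' : slab 3 k := vtx k (xL + 1, rB) (ht x) with hw''
  have hE₁'T : planar k E₁' ∈ T := by rw [hE₁', planar_vtx, mem_boxR_iff]; omega
  have hw''T : planar k w'' ∈ T := by rw [hw'', planar_vtx, mem_boxR_iff]; omega
  have hxT : planar k x ∉ T := by rw [hx, mem_boxR_iff]; omega
  have hE₁T : planar k E₁ ∉ T := by rw [hE₁, mem_boxR_iff]; omega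
  have hm₁T : planar k m₁ ∉ T := by rw [hm₁, planar_vtx, mem_boxR_iff]; omega
  have hxD : planar k x ∈ D := by rw [hx, mem_boxR_iff]; omega
  have hE₁D : planar k E₁ ∈ D := by rw [hE₁, mem_boxR_iff]; omega
  have hm₁D : planar k m₁ ∈ D := by rw [hm₁, planar_vtx, mem_boxR_iff]; omega
  have hE₁'w'' : planar k E₁' ≠ planar k w'' := by
    rw [hE₁', hw'', planar_vtx, planar_vtx]; intro h; have := congrArg Prod.snd h; simp at this
  have hadj_w''x : (slabGraph 3 k).Adj w'' x :=
    adj_of_cells (ht_vtx_ht _ _) (by rw [hw'', planar_vtx, hx]; exact padj_l xL rB)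
  have hadj_m₁E₁' : (slabGraph 3 k).Adj m₁ E₁' :=
    adj_of_cells (by rw [ht_vtx_ht, ht_vtx_ht]) (by rw [hm₁, hE₁', planar_vtx, planar_vtx]; exact padj_r xL (rB + 1))
  have hadj_E₁m₁ : (slabGraph 3 k).Adj E₁ m₁ :=
    adj_of_cells (by rw [ht_vtx_ht]) (by rw [hm₁, planar_vtx, hE₁]; exact padj_u xL rB)
  have hm₁x : m₁ ≠ x := ne_of_planar_ne (by rw [hm₁, planar_vtx, hx]; intro h; have := congrArg Prod.snd h; simp at this)
  have hE₁m₁ : E₁ ≠ m₁ := ne_of_planar_ne (by rw [hm₁, planar_vtx, hE₁]; intro h; have := congrArg Prod.snd h; simp at this)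
  -- the three-step extension common to both cases
  have extend : ∀ {E₂' : slab 3 k} {L' Br' : List (slab 3 k)} {c : slab 3 k},
      RouteSpec k T T E₁' E₂' w'' L' Br' c →
      RouteSpec k D D E₁ E₂' x (E₁ :: m₁ :: L') (Br' ++ [x]) c := by
    intro E₂' L' Br' c spec
    have s1 := RouteSpec.concat_branch spec (Db' := D) hTD hadj_w''x (not_mem_of_not_mem_region spec.hL_sub hxT)
      (by intro h; rcases List.mem_cons.1 h with h | h
          · exact hxT (h ▸ spec.hL_sub c spec.hc)
          · exact hxT (spec.hBr_sub x h)) hxD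
    have s2 := RouteSpec.cons_trunk s1 (RP' := D) hTD hadj_m₁E₁' (not_mem_of_not_mem_region spec.hL_sub hm₁T)
      (by intro h; rcases List.mem_append.1 h with h | h
          · exact hm₁T (spec.hBr_sub _ h)
          · exact hm₁x (List.mem_singleton.1 h)) hm₁D
    exact RouteSpec.cons_trunk s2 (RP' := D) subset_rfl hadj_E₁m₁
      (by intro h; rcases List.mem_cons.1 h with h | h
          · exact hE₁m₁ h
          · exact hE₁T (spec.hL_sub _ h))
      (by intro h; rcases List.mem_append.1 h with h | h
          · exact hE₁T (spec.hBr_sub _ h)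
          · exact hE₁x (List.mem_singleton.1 h)) hE₁D
  by_cases hcol : (planar k E₂).1 = xL
  · -- `E₂` on the left column, above the corner: enter the sub-box by one step to the right
    set E₂' : slab 3 k := vtx k (xL + 1, (planar k E₂).2) (ht E₂) with hE₂'
    have hj : rB + 1 ≤ (planar k E₂).2 := by
      rw [mem_boxR_iff] at hE₂D
      rcases lt_or_eq_of_le hE₂D.2.2.1 with h | h
      · omega
      · exfalso; apply hE₂a; ext <;> simp [hcol, h]
    have hE₂'T : planar k E₂' ∈ T := by rw [hE₂', planar_vtx, mem_boxR_iff]; rw [mem_boxR_iff] at hE₂D; omega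
    have hne : E₁' ≠ E₂' := by
      intro h
      apply hE₂d
      have h1 : planar k E₁' = planar k E₂' := by rw [h]
      have h2 : ht E₁' = ht E₂' := by rw [h]
      rw [hE₁', hE₂', planar_vtx, planar_vtx] at h1
      rw [hE₁', hE₂', ht_vtx_ht, ht_vtx_ht] at h2
      rw [slab_ext_iff, planar_vtx, ht_vtx (ht_le E₁), ← h2]
      refine ⟨?_, rfl⟩
      have := congrArg Prod.snd h1; simp only at this
      ext <;> simp [hcol, this]
    have hbd : planar k E₂' ≠ planar k w'' := by
      rw [hE₂', hw'', planar_vtx, planar_vtx]; intro h; have := congrArg Prod.snd h; simp at this; omega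
    obtain ⟨L', Br', c, spec⟩ := exists_route hk (by omega) le_rfl hrows le_rfl hE₁'T hE₂'T hw''T hne
      hE₁'w'' hbd
    have s3 := extend spec
    have hadj_E₂ : (slabGraph 3 k).Adj E₂' E₂ :=
      adj_of_cells (ht_vtx_ht _ _) (by
        rw [hE₂', planar_vtx]
        have : planar k E₂ = (xL, (planar k E₂).2) := by ext <;> simp [hcol]
        rw [this]; exact padj_l xL _)
    have hE₂T : planar k E₂ ∉ T := by rw [mem_boxR_iff]; omega
    refine ⟨_, _, _, RouteSpec.concat_trunk s3 (RP' := D) subset_rfl hadj_E₂ ?_ ?_ hE₂D⟩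
    · intro h
      rcases List.mem_cons.1 h with h | h
      · exact hE₂a (by rw [h, hE₁])
      · rcases List.mem_cons.1 h with h | h
        · apply hE₂d
          rw [h]
        · exact hE₂T (spec.hL_sub _ h)
    · intro h
      rcases List.mem_append.1 h with h | h
      · exact hE₂T (spec.hBr_sub _ h)
      · exact hE₂x (List.mem_singleton.1 h)
  · -- `E₂` inside the sub-box
    have hE₂T : planar k E₂ ∈ T := by rw [mem_boxR_iff] at hE₂D ⊢; omega
    have hne : E₁' ≠ E₂ := fun h => hE₂c (by rw [← h, hE₁', planar_vtx])
    have hbd : planar k E₂ ≠ planar k w'' := by rw [hw'', planar_vtx]; exact hE₂b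
    obtain ⟨L', Br', c, spec⟩ := exists_route hk (by omega) le_rfl hrows le_rfl hE₁'T hE₂T hw''T hne
      hE₁'w'' hbd
    exact ⟨_, _, _, extend spec⟩

/-- Distinct vertices over one cell have different heights. [folklore] -/
private theorem ht_ne_of_ne {v w : slab 3 k} (hvw : v ≠ w) (hp : planar k v = planar k w) : ht v ≠ ht w :=
  fun h => hvw ((slab_ext_iff v w).2 ⟨hp, h⟩)

/-- **Bottom-left corner, `E₁` over the corner cell and `E₂` right above it at the same height.**
Route: trunk `E₁ → (xL+1,rB) ⇝ (xL+1,rB+2) → (xL,rB+2) → E₂`, branch `⇝ (xL+1,rB+1) → (xL,rB+1) → x`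
(the vertex of the branch over `(xL,rB+1)` has the height of `x`, which differs from that of `E₂`).
[cite: NewmanTassionWu2017, §3.2 (proof of Theorem 3.7, steps (1)–(3))] -/
theorem route_cornerBL_fst' (hk : 1 ≤ k) (hcols : xL + 3 ≤ xR) (hrows : rB + 3 ≤ rT)
    {E₁ E₂ x : slab 3 k} (hE₁ : planar k E₁ = (xL, rB)) (hx : planar k x = (xL, rB)) (hE₁x : E₁ ≠ x)
    (hE₂ : planar k E₂ = (xL, rB + 1)) (hE₂h : ht E₂ = ht E₁) :
    ∃ L Br c, RouteSpec k (boxR xL xR rB rT) (boxR xL xR rB rT) E₁ E₂ x L Br c := by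
  set D := boxR xL xR rB rT with hD
  set T := boxR (xL + 1) xR rB rT with hT
  have hTD : T ⊆ D := sub_left xL xR rB rT
  have hhx : ht E₁ ≠ ht x := ht_ne_of_ne hE₁x (by rw [hE₁, hx])
  set E₁' : slab 3 k := vtx k (xL + 1, rB) (ht E₁) with hE₁'
  set mx : slab 3 k := vtx k (xL, rB + 1) (ht x) with hmx
  set w'' : slab 3 k := vtx k (xL + 1, rB + 1) (ht x) with hw''
  set m₂ : slab 3 k := vtx k (xL, rB + 2) (ht E₂) with hm₂
  set E₂' : slab 3 k := vtx k (xL + 1, rB + 2) (ht E₂) with hE₂'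
  have hE₁'T : planar k E₁' ∈ T := by rw [hE₁', planar_vtx, mem_boxR_iff]; omega
  have hE₂'T : planar k E₂' ∈ T := by rw [hE₂', planar_vtx, mem_boxR_iff]; omega
  have hw''T : planar k w'' ∈ T := by rw [hw'', planar_vtx, mem_boxR_iff]; omega
  have hxT : planar k x ∉ T := by rw [hx, mem_boxR_iff]; omega
  have hE₁T : planar k E₁ ∉ T := by rw [hE₁, mem_boxR_iff]; omega
  have hE₂T : planar k E₂ ∉ T := by rw [hE₂, mem_boxR_iff]; omega
  have hmxT : planar k mx ∉ T := by rw [hmx, planar_vtx, mem_boxR_iff]; omega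
  have hm₂T : planar k m₂ ∉ T := by rw [hm₂, planar_vtx, mem_boxR_iff]; omega
  have hxD : planar k x ∈ D := by rw [hx, mem_boxR_iff]; omega
  have hE₁D : planar k E₁ ∈ D := by rw [hE₁, mem_boxR_iff]; omega
  have hE₂D : planar k E₂ ∈ D := by rw [hE₂, mem_boxR_iff]; omega
  have hmxD : planar k mx ∈ D := by rw [hmx, planar_vtx, mem_boxR_iff]; omega
  have hm₂D : planar k m₂ ∈ D := by rw [hm₂, planar_vtx, mem_boxR_iff]; omega
  have hne : E₁' ≠ E₂' := ne_of_planar_ne (by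
    rw [hE₁', hE₂', planar_vtx, planar_vtx]; intro h; have := congrArg Prod.snd h; simp at this)
  have had : planar k E₁' ≠ planar k w'' := by
    rw [hE₁', hw'', planar_vtx, planar_vtx]; intro h; have := congrArg Prod.snd h; simp at this
  have hbd : planar k E₂' ≠ planar k w'' := by
    rw [hE₂', hw'', planar_vtx, planar_vtx]; intro h; have := congrArg Prod.snd h; simp at this
  obtain ⟨L', Br', c, spec⟩ := exists_route hk (by omega) le_rfl hrows le_rfl hE₁'T hE₂'T hw''T hne had hbd
  -- branch: `w'' → mx → x`
  have s1 := RouteSpec.concat_branch spec (Db' := D) hTD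
    (adj_of_cells (by rw [hw'', hmx, ht_vtx_ht, ht_vtx_ht]) (by rw [hw'', hmx, planar_vtx, planar_vtx]; exact padj_l xL (rB + 1)))
    (not_mem_of_not_mem_region spec.hL_sub hmxT)
    (by intro h; rcases List.mem_cons.1 h with h | h
        · exact hmxT (h ▸ spec.hL_sub c spec.hc)
        · exact hmxT (spec.hBr_sub _ h)) hmxD
  have s2 := RouteSpec.concat_branch s1 (Db' := D) subset_rfl
    (adj_of_cells (by rw [hmx, ht_vtx_ht]) (by rw [hmx, planar_vtx, hx]; exact padj_d xL rB))
    (not_mem_of_not_mem_region spec.hL_sub hxT)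
    (by intro h; rcases List.mem_cons.1 h with h | h
        · exact hxT (h ▸ spec.hL_sub c spec.hc)
        · rcases List.mem_append.1 h with h | h
          · exact hxT (spec.hBr_sub _ h)
          · exact (ne_of_planar_ne (by rw [hmx, planar_vtx, hx]; intro h; have := congrArg Prod.snd h; simp at this))
              (List.mem_singleton.1 h).symm) hxD
  -- trunk start: `E₁ → E₁'`
  have s3 := RouteSpec.cons_trunk s2 (RP' := D) hTD
    (adj_of_cells (by rw [hE₁', ht_vtx_ht]) (by rw [hE₁', planar_vtx, hE₁]; exact padj_r xL rB))
    (not_mem_of_not_mem_region spec.hL_sub hE₁T)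
    (by intro h
        rcases List.mem_append.1 h with h | h
        · rcases List.mem_append.1 h with h | h
          · exact hE₁T (spec.hBr_sub _ h)
          · exact (ne_of_planar_ne (show planar k E₁ ≠ planar k mx by
              rw [hmx, planar_vtx, hE₁]; intro h; have := congrArg Prod.snd h; simp at this)) (List.mem_singleton.1 h)
        · exact hE₁x (List.mem_singleton.1 h)) hE₁D
  -- trunk end: `E₂' → m₂ → E₂`
  have s4 := RouteSpec.concat_trunk s3 (RP' := D) subset_rfl
    (adj_of_cells (by rw [hE₂', hm₂, ht_vtx_ht, ht_vtx_ht]) (by rw [hE₂', hm₂, planar_vtx, planar_vtx]; exact padj_l xL (rB + 2)))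
    (by intro h; rcases List.mem_cons.1 h with h | h
        · exact (ne_of_planar_ne (show planar k m₂ ≠ planar k E₁ by
            rw [hm₂, planar_vtx, hE₁]; intro h; have := congrArg Prod.snd h; simp at this)) h
        · exact hm₂T (spec.hL_sub _ h))
    (by intro h
        rcases List.mem_append.1 h with h | h
        · rcases List.mem_append.1 h with h | h
          · exact hm₂T (spec.hBr_sub _ h)
          · exact (ne_of_planar_ne (show planar k m₂ ≠ planar k mx by
              rw [hm₂, hmx, planar_vtx, planar_vtx]; intro h; have := congrArg Prod.snd h; simp at this)) (List.mem_singleton.1 h)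
        · exact (ne_of_planar_ne (show planar k m₂ ≠ planar k x by
              rw [hm₂, planar_vtx, hx]; intro h; have := congrArg Prod.snd h; simp at this)) (List.mem_singleton.1 h))
    hm₂D
  refine ⟨_, _, _, RouteSpec.concat_trunk s4 (RP' := D) subset_rfl
    (adj_of_cells (by rw [hm₂, ht_vtx_ht]) (by
      rw [hm₂, planar_vtx, hE₂]
      have : (rB : ℤ) + 2 = rB + 1 + 1 := by ring
      rw [this]; exact padj_d xL (rB + 1))) ?_ ?_ hE₂D⟩
  · intro h
    rcases List.mem_append.1 h with h | h
    · rcases List.mem_cons.1 h with h | h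
      · exact (ne_of_planar_ne (show planar k E₂ ≠ planar k E₁ by
          rw [hE₂, hE₁]; intro h; have := congrArg Prod.snd h; simp at this)) h
      · exact hE₂T (spec.hL_sub _ h)
    · exact (ne_of_planar_ne (show planar k E₂ ≠ planar k m₂ by
          rw [hE₂, hm₂, planar_vtx]; intro h; have := congrArg Prod.snd h; simp at this)) (List.mem_singleton.1 h)
  · intro h
    rcases List.mem_append.1 h with h | h
    · rcases List.mem_append.1 h with h | h
      · exact hE₂T (spec.hBr_sub _ h)
      · -- `E₂ ≠ mx`: same cell, heights `ht E₁ ≠ ht x`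
        have := List.mem_singleton.1 h
        apply hhx
        rw [← hE₂h, this, hmx, ht_vtx_ht]
    · exact (ne_of_planar_ne (show planar k E₂ ≠ planar k x by
          rw [hE₂, hx]; intro h; have := congrArg Prod.snd h; simp at this)) (List.mem_singleton.1 h)

/-- **Bottom-left corner, `E₂` over the corner cell.** `E₂` and the branch end `x ≠ E₂` over
`Z = (xL, rB)`, `E₁` over `D` off the cells `Z`, `(xL+1, rB)`, `(xL+1, rB+1)`, different from `x` and
from the vertex above `E₂`: trunk `E₁ ⇝ (xL+1,rB+1) → (xL,rB+1) → E₂`, branch `⇝ (xL+1,rB) → x`.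
[cite: NewmanTassionWu2017, §3.2 (proof of Theorem 3.7, steps (1)–(3))] -/
theorem route_cornerBL_snd (hk : 1 ≤ k) (hcols : xL + 3 ≤ xR) (hrows : rB + 3 ≤ rT)
    {E₁ E₂ x : slab 3 k} (hE₂ : planar k E₂ = (xL, rB)) (hx : planar k x = (xL, rB)) (hE₂x : E₂ ≠ x)
    (hE₁D : planar k E₁ ∈ boxR xL xR rB rT) (hE₁a : planar k E₁ ≠ (xL, rB))
    (hE₁b : planar k E₁ ≠ (xL + 1, rB)) (hE₁c : planar k E₁ ≠ (xL + 1, rB + 1))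
    (hE₁d : E₁ ≠ vtx k (xL, rB + 1) (ht E₂)) (hE₁x : E₁ ≠ x) :
    ∃ L Br c, RouteSpec k (boxR xL xR rB rT) (boxR xL xR rB rT) E₁ E₂ x L Br c := by
  set D := boxR xL xR rB rT with hD
  set T := boxR (xL + 1) xR rB rT with hT
  have hTD : T ⊆ D := sub_left xL xR rB rT
  set m₂ : slab 3 k := vtx k (xL, rB + 1) (ht E₂) with hm₂
  set E₂' : slab 3 k := vtx k (xL + 1, rB + 1) (ht E₂) with hE₂'
  set w'' : slab 3 k := vtx k (xL + 1, rB) (ht x) with hw''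
  have hE₂'T : planar k E₂' ∈ T := by rw [hE₂', planar_vtx, mem_boxR_iff]; omega
  have hw''T : planar k w'' ∈ T := by rw [hw'', planar_vtx, mem_boxR_iff]; omega
  have hxT : planar k x ∉ T := by rw [hx, mem_boxR_iff]; omega
  have hE₂T : planar k E₂ ∉ T := by rw [hE₂, mem_boxR_iff]; omega
  have hm₂T : planar k m₂ ∉ T := by rw [hm₂, planar_vtx, mem_boxR_iff]; omega
  have hxD : planar k x ∈ D := by rw [hx, mem_boxR_iff]; omega
  have hE₂D : planar k E₂ ∈ D := by rw [hE₂, mem_boxR_iff]; omega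
  have hm₂D : planar k m₂ ∈ D := by rw [hm₂, planar_vtx, mem_boxR_iff]; omega
  have hbd : planar k E₂' ≠ planar k w'' := by
    rw [hE₂', hw'', planar_vtx, planar_vtx]; intro h; have := congrArg Prod.snd h; simp at this
  have hm₂x : m₂ ≠ x := ne_of_planar_ne (by rw [hm₂, planar_vtx, hx]; intro h; have := congrArg Prod.snd h; simp at this)
  have hE₂m₂ : E₂ ≠ m₂ := ne_of_planar_ne (by rw [hm₂, planar_vtx, hE₂]; intro h; have := congrArg Prod.snd h; simp at this)
  -- the three-step extension at the end of the trunk and the branch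
  have extend : ∀ {E₁' : slab 3 k} {L' Br' : List (slab 3 k)} {c : slab 3 k},
      RouteSpec k T T E₁' E₂' w'' L' Br' c →
      RouteSpec k D D E₁' E₂ x ((L' ++ [m₂]) ++ [E₂]) (Br' ++ [x]) c := by
    intro E₁' L' Br' c spec
    have s1 := RouteSpec.concat_branch spec (Db' := D) hTD
      (adj_of_cells (ht_vtx_ht _ _) (by rw [hw'', planar_vtx, hx]; exact padj_l xL rB))
      (not_mem_of_not_mem_region spec.hL_sub hxT)
      (by intro h; rcases List.mem_cons.1 h with h | h
          · exact hxT (h ▸ spec.hL_sub c spec.hc)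
          · exact hxT (spec.hBr_sub x h)) hxD
    have s2 := RouteSpec.concat_trunk s1 (RP' := D) hTD
      (adj_of_cells (by rw [hE₂', hm₂, ht_vtx_ht, ht_vtx_ht]) (by rw [hE₂', hm₂, planar_vtx, planar_vtx]; exact padj_l xL (rB + 1)))
      (not_mem_of_not_mem_region spec.hL_sub hm₂T)
      (by intro h; rcases List.mem_append.1 h with h | h
          · exact hm₂T (spec.hBr_sub _ h)
          · exact hm₂x (List.mem_singleton.1 h)) hm₂D
    exact RouteSpec.concat_trunk s2 (RP' := D) subset_rfl
      (adj_of_cells (by rw [hm₂, ht_vtx_ht]) (by rw [hm₂, planar_vtx, hE₂]; exact padj_d xL rB))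
      (by intro h; rcases List.mem_append.1 h with h | h
          · exact hE₂T (spec.hL_sub _ h)
          · exact hE₂m₂ (List.mem_singleton.1 h))
      (by intro h; rcases List.mem_append.1 h with h | h
          · exact hE₂T (spec.hBr_sub _ h)
          · exact hE₂x (List.mem_singleton.1 h)) hE₂D
  by_cases hcol : (planar k E₁).1 = xL
  · -- `E₁` on the left column, above the corner: enter the sub-box by one step to the right
    set E₁' : slab 3 k := vtx k (xL + 1, (planar k E₁).2) (ht E₁) with hE₁'
    have hj : rB + 1 ≤ (planar k E₁).2 := by
      rw [mem_boxR_iff] at hE₁D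
      rcases lt_or_eq_of_le hE₁D.2.2.1 with h | h
      · omega
      · exfalso; apply hE₁a; ext <;> simp [hcol, h]
    have hE₁'T : planar k E₁' ∈ T := by rw [hE₁', planar_vtx, mem_boxR_iff]; rw [mem_boxR_iff] at hE₁D; omega
    have hne : E₁' ≠ E₂' := by
      intro h
      apply hE₁d
      have h1 : planar k E₁' = planar k E₂' := by rw [h]
      have h2 : ht E₁' = ht E₂' := by rw [h]
      rw [hE₁', hE₂', planar_vtx, planar_vtx] at h1
      rw [hE₁', hE₂', ht_vtx_ht, ht_vtx_ht] at h2
      rw [slab_ext_iff, planar_vtx, ht_vtx (ht_le E₂), h2]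
      refine ⟨?_, rfl⟩
      have := congrArg Prod.snd h1; simp only at this
      ext <;> simp [hcol, this]
    have had : planar k E₁' ≠ planar k w'' := by
      rw [hE₁', hw'', planar_vtx, planar_vtx]; intro h; have := congrArg Prod.snd h; simp at this; omega
    obtain ⟨L', Br', c, spec⟩ := exists_route hk (by omega) le_rfl hrows le_rfl hE₁'T hE₂'T hw''T hne had hbd
    have s3 := extend spec
    have hadj_E₁ : (slabGraph 3 k).Adj E₁ E₁' :=
      adj_of_cells (by rw [hE₁', ht_vtx_ht]) (by
        rw [hE₁', planar_vtx]
        have : planar k E₁ = (xL, (planar k E₁).2) := by ext <;> simp [hcol]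
        rw [this]; exact padj_r xL _)
    have hE₁T : planar k E₁ ∉ T := by rw [mem_boxR_iff]; omega
    refine ⟨_, _, _, RouteSpec.cons_trunk s3 (RP' := D) subset_rfl hadj_E₁ ?_ ?_ hE₁D⟩
    · intro h
      rcases List.mem_append.1 h with h | h
      · rcases List.mem_append.1 h with h | h
        · exact hE₁T (spec.hL_sub _ h)
        · exact hE₁d (List.mem_singleton.1 h)
      · exact hE₁a (by rw [List.mem_singleton.1 h, hE₂])
    · intro h
      rcases List.mem_append.1 h with h | h
      · exact hE₁T (spec.hBr_sub _ h)
      · exact hE₁x (List.mem_singleton.1 h)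
  · -- `E₁` inside the sub-box
    have hE₁T : planar k E₁ ∈ T := by rw [mem_boxR_iff] at hE₁D ⊢; omega
    have hne : E₁ ≠ E₂' := fun h => hE₁c (by rw [h, hE₂', planar_vtx])
    have had : planar k E₁ ≠ planar k w'' := by rw [hw'', planar_vtx]; exact hE₁b
    obtain ⟨L', Br', c, spec⟩ := exists_route hk (by omega) le_rfl hrows le_rfl hE₁T hE₂'T hw''T hne had hbd
    exact ⟨_, _, _, extend spec⟩

/-- **Bottom-left corner, `E₂` over the corner cell and `E₁` right above it at the same height.**
Route: trunk `E₁ → (xL,rB+2) → (xL+1,rB+2) ⇝ (xL+1,rB) → E₂`, branch `⇝ (xL+1,rB+1) → (xL,rB+1) → x`.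
[cite: NewmanTassionWu2017, §3.2 (proof of Theorem 3.7, steps (1)–(3))] -/
theorem route_cornerBL_snd' (hk : 1 ≤ k) (hcols : xL + 3 ≤ xR) (hrows : rB + 3 ≤ rT)
    {E₁ E₂ x : slab 3 k} (hE₂ : planar k E₂ = (xL, rB)) (hx : planar k x = (xL, rB)) (hE₂x : E₂ ≠ x)
    (hE₁ : planar k E₁ = (xL, rB + 1)) (hE₁h : ht E₁ = ht E₂) :
    ∃ L Br c, RouteSpec k (boxR xL xR rB rT) (boxR xL xR rB rT) E₁ E₂ x L Br c := by
  set D := boxR xL xR rB rT with hD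
  set T := boxR (xL + 1) xR rB rT with hT
  have hTD : T ⊆ D := sub_left xL xR rB rT
  have hhx : ht E₂ ≠ ht x := ht_ne_of_ne hE₂x (by rw [hE₂, hx])
  set E₂' : slab 3 k := vtx k (xL + 1, rB) (ht E₂) with hE₂'
  set mx : slab 3 k := vtx k (xL, rB + 1) (ht x) with hmx
  set w'' : slab 3 k := vtx k (xL + 1, rB + 1) (ht x) with hw''
  set m₁ : slab 3 k := vtx k (xL, rB + 2) (ht E₁) with hm₁
  set E₁' : slab 3 k := vtx k (xL + 1, rB + 2) (ht E₁) with hE₁'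
  have hE₁'T : planar k E₁' ∈ T := by rw [hE₁', planar_vtx, mem_boxR_iff]; omega
  have hE₂'T : planar k E₂' ∈ T := by rw [hE₂', planar_vtx, mem_boxR_iff]; omega
  have hw''T : planar k w'' ∈ T := by rw [hw'', planar_vtx, mem_boxR_iff]; omega
  have hxT : planar k x ∉ T := by rw [hx, mem_boxR_iff]; omega
  have hE₁T : planar k E₁ ∉ T := by rw [hE₁, mem_boxR_iff]; omega
  have hE₂T : planar k E₂ ∉ T := by rw [hE₂, mem_boxR_iff]; omega
  have hmxT : planar k mx ∉ T := by rw [hmx, planar_vtx, mem_boxR_iff]; omega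
  have hm₁T : planar k m₁ ∉ T := by rw [hm₁, planar_vtx, mem_boxR_iff]; omega
  have hxD : planar k x ∈ D := by rw [hx, mem_boxR_iff]; omega
  have hE₁D : planar k E₁ ∈ D := by rw [hE₁, mem_boxR_iff]; omega
  have hE₂D : planar k E₂ ∈ D := by rw [hE₂, mem_boxR_iff]; omega
  have hmxD : planar k mx ∈ D := by rw [hmx, planar_vtx, mem_boxR_iff]; omega
  have hm₁D : planar k m₁ ∈ D := by rw [hm₁, planar_vtx, mem_boxR_iff]; omega
  have hne : E₁' ≠ E₂' := ne_of_planar_ne (by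
    rw [hE₁', hE₂', planar_vtx, planar_vtx]; intro h; have := congrArg Prod.snd h; simp at this)
  have had : planar k E₁' ≠ planar k w'' := by
    rw [hE₁', hw'', planar_vtx, planar_vtx]; intro h; have := congrArg Prod.snd h; simp at this
  have hbd : planar k E₂' ≠ planar k w'' := by
    rw [hE₂', hw'', planar_vtx, planar_vtx]; intro h; have := congrArg Prod.snd h; simp at this
  obtain ⟨L', Br', c, spec⟩ := exists_route hk (by omega) le_rfl hrows le_rfl hE₁'T hE₂'T hw''T hne had hbd
  -- branch: `w'' → mx → x`
  have s1 := RouteSpec.concat_branch spec (Db' := D) hTD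
    (adj_of_cells (by rw [hw'', hmx, ht_vtx_ht, ht_vtx_ht]) (by rw [hw'', hmx, planar_vtx, planar_vtx]; exact padj_l xL (rB + 1)))
    (not_mem_of_not_mem_region spec.hL_sub hmxT)
    (by intro h; rcases List.mem_cons.1 h with h | h
        · exact hmxT (h ▸ spec.hL_sub c spec.hc)
        · exact hmxT (spec.hBr_sub _ h)) hmxD
  have s2 := RouteSpec.concat_branch s1 (Db' := D) subset_rfl
    (adj_of_cells (by rw [hmx, ht_vtx_ht]) (by rw [hmx, planar_vtx, hx]; exact padj_d xL rB))
    (not_mem_of_not_mem_region spec.hL_sub hxT)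
    (by intro h; rcases List.mem_cons.1 h with h | h
        · exact hxT (h ▸ spec.hL_sub c spec.hc)
        · rcases List.mem_append.1 h with h | h
          · exact hxT (spec.hBr_sub _ h)
          · exact (ne_of_planar_ne (by rw [hmx, planar_vtx, hx]; intro h; have := congrArg Prod.snd h; simp at this))
              (List.mem_singleton.1 h).symm) hxD
  -- trunk end: `E₂' → E₂`
  have s3 := RouteSpec.concat_trunk s2 (RP' := D) hTD
    (adj_of_cells (by rw [hE₂', ht_vtx_ht]) (by rw [hE₂', planar_vtx, hE₂]; exact padj_l xL rB))
    (not_mem_of_not_mem_region spec.hL_sub hE₂T)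
    (by intro h
        rcases List.mem_append.1 h with h | h
        · rcases List.mem_append.1 h with h | h
          · exact hE₂T (spec.hBr_sub _ h)
          · exact (ne_of_planar_ne (show planar k E₂ ≠ planar k mx by
              rw [hmx, planar_vtx, hE₂]; intro h; have := congrArg Prod.snd h; simp at this)) (List.mem_singleton.1 h)
        · exact hE₂x (List.mem_singleton.1 h)) hE₂D
  -- trunk start: `E₁ → m₁ → E₁'`
  have s4 := RouteSpec.cons_trunk s3 (RP' := D) subset_rfl
    (adj_of_cells (by rw [hm₁, hE₁', ht_vtx_ht, ht_vtx_ht]) (by rw [hm₁, hE₁', planar_vtx, planar_vtx]; exact padj_r xL (rB + 2)))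
    (by intro h; rcases List.mem_append.1 h with h | h
        · exact hm₁T (spec.hL_sub _ h)
        · exact (ne_of_planar_ne (show planar k m₁ ≠ planar k E₂ by
            rw [hm₁, planar_vtx, hE₂]; intro h; have := congrArg Prod.snd h; simp at this)) (List.mem_singleton.1 h))
    (by intro h
        rcases List.mem_append.1 h with h | h
        · rcases List.mem_append.1 h with h | h
          · exact hm₁T (spec.hBr_sub _ h)
          · exact (ne_of_planar_ne (show planar k m₁ ≠ planar k mx by
              rw [hm₁, hmx, planar_vtx, planar_vtx]; intro h; have := congrArg Prod.snd h; simp at this)) (List.mem_singleton.1 h)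
        · exact (ne_of_planar_ne (show planar k m₁ ≠ planar k x by
              rw [hm₁, planar_vtx, hx]; intro h; have := congrArg Prod.snd h; simp at this)) (List.mem_singleton.1 h))
    hm₁D
  refine ⟨_, _, _, RouteSpec.cons_trunk s4 (RP' := D) subset_rfl
    (adj_of_cells (by rw [hm₁, ht_vtx_ht]) (by
      rw [hm₁, planar_vtx, hE₁]
      have : (rB : ℤ) + 2 = rB + 1 + 1 := by ring
      rw [this]; exact padj_u xL (rB + 1))) ?_ ?_ hE₁D⟩
  · intro h
    rcases List.mem_cons.1 h with h | h
    · exact (ne_of_planar_ne (show planar k E₁ ≠ planar k m₁ by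
          rw [hE₁, hm₁, planar_vtx]; intro h; have := congrArg Prod.snd h; simp at this)) h
    · rcases List.mem_append.1 h with h | h
      · exact hE₁T (spec.hL_sub _ h)
      · exact (ne_of_planar_ne (show planar k E₁ ≠ planar k E₂ by
          rw [hE₁, hE₂]; intro h; have := congrArg Prod.snd h; simp at this)) (List.mem_singleton.1 h)
  · intro h
    rcases List.mem_append.1 h with h | h
    · rcases List.mem_append.1 h with h | h
      · exact hE₁T (spec.hBr_sub _ h)
      · -- `E₁ ≠ mx`: same cell, heights `ht E₂ ≠ ht x`
        have := List.mem_singleton.1 h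
        apply hhx
        rw [← hE₁h, this, hmx, ht_vtx_ht]
    · exact (ne_of_planar_ne (show planar k E₁ ≠ planar k x by
          rw [hE₁, hx]; intro h; have := congrArg Prod.snd h; simp at this)) (List.mem_singleton.1 h)

/-- **Bottom-left corner, `E₁`, `E₂` and the branch end all over the corner cell** (pairwise
distinct, so of three different heights). Route: trunk `E₁ → (xL+1,rB) ⇝ (xL+1,rB+2) → (xL,rB+2) →
(xL,rB+1) → E₂` (the last two at the height of `E₂`), branch `⇝ (xL+1,rB+1) → (xL,rB+1) → x` (at the
height of `x`). [cite: NewmanTassionWu2017, §3.2 (proof of Theorem 3.7, steps (1)–(3))] -/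
theorem route_cornerBL_both (hk : 1 ≤ k) (hcols : xL + 3 ≤ xR) (hrows : rB + 3 ≤ rT)
    {E₁ E₂ x : slab 3 k} (hE₁ : planar k E₁ = (xL, rB)) (hE₂ : planar k E₂ = (xL, rB))
    (hx : planar k x = (xL, rB)) (hE₁₂ : E₁ ≠ E₂) (hE₁x : E₁ ≠ x) (hE₂x : E₂ ≠ x) :
    ∃ L Br c, RouteSpec k (boxR xL xR rB rT) (boxR xL xR rB rT) E₁ E₂ x L Br c := by
  set D := boxR xL xR rB rT with hD
  set T := boxR (xL + 1) xR rB rT with hT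
  have hTD : T ⊆ D := sub_left xL xR rB rT
  have hh₂x : ht E₂ ≠ ht x := ht_ne_of_ne hE₂x (by rw [hE₂, hx])
  have hh₁₂ : ht E₁ ≠ ht E₂ := ht_ne_of_ne hE₁₂ (by rw [hE₁, hE₂])
  have hh₁x : ht E₁ ≠ ht x := ht_ne_of_ne hE₁x (by rw [hE₁, hx])
  set E₁' : slab 3 k := vtx k (xL + 1, rB) (ht E₁) with hE₁'
  set mx : slab 3 k := vtx k (xL, rB + 1) (ht x) with hmx
  set w'' : slab 3 k := vtx k (xL + 1, rB + 1) (ht x) with hw''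
  set m₂a : slab 3 k := vtx k (xL, rB + 1) (ht E₂) with hm₂a
  set m₂b : slab 3 k := vtx k (xL, rB + 2) (ht E₂) with hm₂b
  set E₂' : slab 3 k := vtx k (xL + 1, rB + 2) (ht E₂) with hE₂'
  have hE₁'T : planar k E₁' ∈ T := by rw [hE₁', planar_vtx, mem_boxR_iff]; omega
  have hE₂'T : planar k E₂' ∈ T := by rw [hE₂', planar_vtx, mem_boxR_iff]; omega
  have hw''T : planar k w'' ∈ T := by rw [hw'', planar_vtx, mem_boxR_iff]; omega
  have hxT : planar k x ∉ T := by rw [hx, mem_boxR_iff]; omega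
  have hE₁T : planar k E₁ ∉ T := by rw [hE₁, mem_boxR_iff]; omega
  have hE₂T : planar k E₂ ∉ T := by rw [hE₂, mem_boxR_iff]; omega
  have hmxT : planar k mx ∉ T := by rw [hmx, planar_vtx, mem_boxR_iff]; omega
  have hm₂aT : planar k m₂a ∉ T := by rw [hm₂a, planar_vtx, mem_boxR_iff]; omega
  have hm₂bT : planar k m₂b ∉ T := by rw [hm₂b, planar_vtx, mem_boxR_iff]; omega
  have hxD : planar k x ∈ D := by rw [hx, mem_boxR_iff]; omega
  have hE₁D : planar k E₁ ∈ D := by rw [hE₁, mem_boxR_iff]; omega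
  have hE₂D : planar k E₂ ∈ D := by rw [hE₂, mem_boxR_iff]; omega
  have hmxD : planar k mx ∈ D := by rw [hmx, planar_vtx, mem_boxR_iff]; omega
  have hm₂aD : planar k m₂a ∈ D := by rw [hm₂a, planar_vtx, mem_boxR_iff]; omega
  have hm₂bD : planar k m₂b ∈ D := by rw [hm₂b, planar_vtx, mem_boxR_iff]; omega
  have hne : E₁' ≠ E₂' := ne_of_planar_ne (by
    rw [hE₁', hE₂', planar_vtx, planar_vtx]; intro h; have := congrArg Prod.snd h; simp at this)
  have had : planar k E₁' ≠ planar k w'' := by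
    rw [hE₁', hw'', planar_vtx, planar_vtx]; intro h; have := congrArg Prod.snd h; simp at this
  have hbd : planar k E₂' ≠ planar k w'' := by
    rw [hE₂', hw'', planar_vtx, planar_vtx]; intro h; have := congrArg Prod.snd h; simp at this
  obtain ⟨L', Br', c, spec⟩ := exists_route hk (by omega) le_rfl hrows le_rfl hE₁'T hE₂'T hw''T hne had hbd
  -- branch: `w'' → mx → x`
  have s1 := RouteSpec.concat_branch spec (Db' := D) hTD
    (adj_of_cells (by rw [hw'', hmx, ht_vtx_ht, ht_vtx_ht]) (by rw [hw'', hmx, planar_vtx, planar_vtx]; exact padj_l xL (rB + 1)))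
    (not_mem_of_not_mem_region spec.hL_sub hmxT)
    (by intro h; rcases List.mem_cons.1 h with h | h
        · exact hmxT (h ▸ spec.hL_sub c spec.hc)
        · exact hmxT (spec.hBr_sub _ h)) hmxD
  have s2 := RouteSpec.concat_branch s1 (Db' := D) subset_rfl
    (adj_of_cells (by rw [hmx, ht_vtx_ht]) (by rw [hmx, planar_vtx, hx]; exact padj_d xL rB))
    (not_mem_of_not_mem_region spec.hL_sub hxT)
    (by intro h; rcases List.mem_cons.1 h with h | h
        · exact hxT (h ▸ spec.hL_sub c spec.hc)
        · rcases List.mem_append.1 h with h | h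
          · exact hxT (spec.hBr_sub _ h)
          · exact (ne_of_planar_ne (by rw [hmx, planar_vtx, hx]; intro h; have := congrArg Prod.snd h; simp at this))
              (List.mem_singleton.1 h).symm) hxD
  -- trunk start: `E₁ → E₁'`
  have s3 := RouteSpec.cons_trunk s2 (RP' := D) hTD
    (adj_of_cells (by rw [hE₁', ht_vtx_ht]) (by rw [hE₁', planar_vtx, hE₁]; exact padj_r xL rB))
    (not_mem_of_not_mem_region spec.hL_sub hE₁T)
    (by intro h
        rcases List.mem_append.1 h with h | h
        · rcases List.mem_append.1 h with h | h
          · exact hE₁T (spec.hBr_sub _ h)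
          · exact (ne_of_planar_ne (show planar k E₁ ≠ planar k mx by
              rw [hmx, planar_vtx, hE₁]; intro h; have := congrArg Prod.snd h; simp at this)) (List.mem_singleton.1 h)
        · exact hE₁x (List.mem_singleton.1 h)) hE₁D
  -- trunk end: `E₂' → m₂b → m₂a → E₂`
  have s4 := RouteSpec.concat_trunk s3 (RP' := D) subset_rfl
    (adj_of_cells (by rw [hE₂', hm₂b, ht_vtx_ht, ht_vtx_ht]) (by rw [hE₂', hm₂b, planar_vtx, planar_vtx]; exact padj_l xL (rB + 2)))
    (by intro h; rcases List.mem_cons.1 h with h | h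
        · exact (ne_of_planar_ne (show planar k m₂b ≠ planar k E₁ by
            rw [hm₂b, planar_vtx, hE₁]; intro h; have := congrArg Prod.snd h; simp at this)) h
        · exact hm₂bT (spec.hL_sub _ h))
    (by intro h
        rcases List.mem_append.1 h with h | h
        · rcases List.mem_append.1 h with h | h
          · exact hm₂bT (spec.hBr_sub _ h)
          · exact (ne_of_planar_ne (show planar k m₂b ≠ planar k mx by
              rw [hm₂b, hmx, planar_vtx, planar_vtx]; intro h; have := congrArg Prod.snd h; simp at this)) (List.mem_singleton.1 h)
        · exact (ne_of_planar_ne (show planar k m₂b ≠ planar k x by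
              rw [hm₂b, planar_vtx, hx]; intro h; have := congrArg Prod.snd h; simp at this)) (List.mem_singleton.1 h))
    hm₂bD
  have s5 := RouteSpec.concat_trunk s4 (RP' := D) subset_rfl
    (adj_of_cells (by rw [hm₂b, hm₂a, ht_vtx_ht, ht_vtx_ht]) (by
      rw [hm₂b, hm₂a, planar_vtx, planar_vtx]
      have : (rB : ℤ) + 2 = rB + 1 + 1 := by ring
      rw [this]; exact padj_d xL (rB + 1)))
    (by intro h
        rcases List.mem_append.1 h with h | h
        · rcases List.mem_cons.1 h with h | h
          · exact (ne_of_planar_ne (show planar k m₂a ≠ planar k E₁ by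
              rw [hm₂a, planar_vtx, hE₁]; intro h; have := congrArg Prod.snd h; simp at this)) h
          · exact hm₂aT (spec.hL_sub _ h)
        · exact (ne_of_planar_ne (show planar k m₂a ≠ planar k m₂b by
              rw [hm₂a, hm₂b, planar_vtx, planar_vtx]; intro h; have := congrArg Prod.snd h; simp at this)) (List.mem_singleton.1 h))
    (by intro h
        rcases List.mem_append.1 h with h | h
        · rcases List.mem_append.1 h with h | h
          · exact hm₂aT (spec.hBr_sub _ h)
          · -- `m₂a ≠ mx`: same cell, heights `ht E₂ ≠ ht x`
            have := List.mem_singleton.1 h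
            apply hh₂x
            have h2 := congrArg ht this
            rwa [hm₂a, hmx, ht_vtx_ht, ht_vtx_ht] at h2
        · exact (ne_of_planar_ne (show planar k m₂a ≠ planar k x by
              rw [hm₂a, planar_vtx, hx]; intro h; have := congrArg Prod.snd h; simp at this)) (List.mem_singleton.1 h))
    hm₂aD
  refine ⟨_, _, _, RouteSpec.concat_trunk s5 (RP' := D) subset_rfl
    (adj_of_cells (by rw [hm₂a, ht_vtx_ht]) (by rw [hm₂a, planar_vtx, hE₂]; exact padj_d xL rB)) ?_ ?_ hE₂D⟩
  · intro h
    rcases List.mem_append.1 h with h | h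
    · rcases List.mem_append.1 h with h | h
      · rcases List.mem_cons.1 h with h | h
        · exact hE₁₂ h.symm
        · exact hE₂T (spec.hL_sub _ h)
      · exact (ne_of_planar_ne (show planar k E₂ ≠ planar k m₂b by
          rw [hE₂, hm₂b, planar_vtx]; intro h; have := congrArg Prod.snd h; simp at this)) (List.mem_singleton.1 h)
    · exact (ne_of_planar_ne (show planar k E₂ ≠ planar k m₂a by
          rw [hE₂, hm₂a, planar_vtx]; intro h; have := congrArg Prod.snd h; simp at this)) (List.mem_singleton.1 h)
  · intro h
    rcases List.mem_append.1 h with h | h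
    · rcases List.mem_append.1 h with h | h
      · exact hE₂T (spec.hBr_sub _ h)
      · exact (ne_of_planar_ne (show planar k E₂ ≠ planar k mx by
          rw [hE₂, hmx, planar_vtx]; intro h; have := congrArg Prod.snd h; simp at this)) (List.mem_singleton.1 h)
    · exact hE₂x (List.mem_singleton.1 h)

end BottomLeft

/-! ## The bottom-right corner -/

section BottomRight

variable {xL xR rB rT : ℤ}

/-- The sub-box without the right column sits inside the box. [folklore] -/
private theorem sub_right (xL xR rB rT : ℤ) : boxR xL (xR - 1) rB rT ⊆ boxR xL xR rB rT := by
  intro z hz; rw [mem_boxR_iff] at hz ⊢; omega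

/-- **Bottom-right corner, `E₂` over the corner cell.** `E₂` and the branch end `x ≠ E₂` over
`Z = (xR, rB)`; `E₁` over `D` off the cells `Z`, `(xR-1, rB)`, `(xR-1, rB+1)`, different from `x` and
from the vertex above `E₂`, and, if on the right column, then at its top cell `(xR, rT)`: trunk
`E₁ (→ (xR-1,rT)) ⇝ (xR-1,rB+1) → (xR,rB+1) → E₂`, branch `⇝ (xR-1,rB) → x`.
[cite: NewmanTassionWu2017, §3.2 (proof of Theorem 3.7, steps (1)–(3))] -/
theorem route_cornerBR_snd (hk : 1 ≤ k) (hcols : xL + 3 ≤ xR) (hrows : rB + 3 ≤ rT)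
    {E₁ E₂ x : slab 3 k} (hE₂ : planar k E₂ = (xR, rB)) (hx : planar k x = (xR, rB)) (hE₂x : E₂ ≠ x)
    (hE₁D : planar k E₁ ∈ boxR xL xR rB rT) (hE₁a : planar k E₁ ≠ (xR, rB))
    (hE₁b : planar k E₁ ≠ (xR - 1, rB)) (hE₁c : planar k E₁ ≠ (xR - 1, rB + 1))
    (hE₁d : E₁ ≠ vtx k (xR, rB + 1) (ht E₂)) (hE₁x : E₁ ≠ x)
    (hE₁top : (planar k E₁).1 = xR → (planar k E₁).2 = rT) :
    ∃ L Br c, RouteSpec k (boxR xL xR rB rT) (boxR xL xR rB rT) E₁ E₂ x L Br c := by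
  set D := boxR xL xR rB rT with hD
  set T := boxR xL (xR - 1) rB rT with hT
  have hTD : T ⊆ D := sub_right xL xR rB rT
  set m₂ : slab 3 k := vtx k (xR, rB + 1) (ht E₂) with hm₂
  set E₂' : slab 3 k := vtx k (xR - 1, rB + 1) (ht E₂) with hE₂'
  set w'' : slab 3 k := vtx k (xR - 1, rB) (ht x) with hw''
  have hE₂'T : planar k E₂' ∈ T := by rw [hE₂', planar_vtx, mem_boxR_iff]; omega
  have hw''T : planar k w'' ∈ T := by rw [hw'', planar_vtx, mem_boxR_iff]; omega
  have hxT : planar k x ∉ T := by rw [hx, mem_boxR_iff]; omega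
  have hE₂T : planar k E₂ ∉ T := by rw [hE₂, mem_boxR_iff]; omega
  have hm₂T : planar k m₂ ∉ T := by rw [hm₂, planar_vtx, mem_boxR_iff]; omega
  have hxD : planar k x ∈ D := by rw [hx, mem_boxR_iff]; omega
  have hE₂D : planar k E₂ ∈ D := by rw [hE₂, mem_boxR_iff]; omega
  have hm₂D : planar k m₂ ∈ D := by rw [hm₂, planar_vtx, mem_boxR_iff]; omega
  have hbd : planar k E₂' ≠ planar k w'' := by
    rw [hE₂', hw'', planar_vtx, planar_vtx]; intro h; have := congrArg Prod.snd h; simp at this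
  have hm₂x : m₂ ≠ x := ne_of_planar_ne (by rw [hm₂, planar_vtx, hx]; intro h; have := congrArg Prod.snd h; simp at this)
  have hE₂m₂ : E₂ ≠ m₂ := ne_of_planar_ne (by rw [hm₂, planar_vtx, hE₂]; intro h; have := congrArg Prod.snd h; simp at this)
  have hxR : (xR : ℤ) = xR - 1 + 1 := by ring
  -- the three-step extension at the end of the trunk and the branch
  have extend : ∀ {E₁' : slab 3 k} {L' Br' : List (slab 3 k)} {c : slab 3 k},
      RouteSpec k T T E₁' E₂' w'' L' Br' c →
      RouteSpec k D D E₁' E₂ x ((L' ++ [m₂]) ++ [E₂]) (Br' ++ [x]) c := by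
    intro E₁' L' Br' c spec
    have s1 := RouteSpec.concat_branch spec (Db' := D) hTD
      (adj_of_cells (ht_vtx_ht _ _) (by
        rw [hw'', planar_vtx, hx]; conv_rhs => rw [hxR]
        exact padj_r (xR - 1) rB))
      (not_mem_of_not_mem_region spec.hL_sub hxT)
      (by intro h; rcases List.mem_cons.1 h with h | h
          · exact hxT (h ▸ spec.hL_sub c spec.hc)
          · exact hxT (spec.hBr_sub x h)) hxD
    have s2 := RouteSpec.concat_trunk s1 (RP' := D) hTD
      (adj_of_cells (by rw [hE₂', hm₂, ht_vtx_ht, ht_vtx_ht]) (by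
        rw [hE₂', hm₂, planar_vtx, planar_vtx]; conv_rhs => rw [hxR]
        exact padj_r (xR - 1) (rB + 1)))
      (not_mem_of_not_mem_region spec.hL_sub hm₂T)
      (by intro h; rcases List.mem_append.1 h with h | h
          · exact hm₂T (spec.hBr_sub _ h)
          · exact hm₂x (List.mem_singleton.1 h)) hm₂D
    exact RouteSpec.concat_trunk s2 (RP' := D) subset_rfl
      (adj_of_cells (by rw [hm₂, ht_vtx_ht]) (by rw [hm₂, planar_vtx, hE₂]; exact padj_d xR rB))
      (by intro h; rcases List.mem_append.1 h with h | h
          · exact hE₂T (spec.hL_sub _ h)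
          · exact hE₂m₂ (List.mem_singleton.1 h))
      (by intro h; rcases List.mem_append.1 h with h | h
          · exact hE₂T (spec.hBr_sub _ h)
          · exact hE₂x (List.mem_singleton.1 h)) hE₂D
  by_cases hcol : (planar k E₁).1 = xR
  · -- `E₁` at the top-right cell: enter the sub-box by one step to the left
    have hrow := hE₁top hcol
    have hE₁eq : planar k E₁ = (xR, rT) := by ext <;> simp [hcol, hrow]
    set E₁' : slab 3 k := vtx k (xR - 1, rT) (ht E₁) with hE₁'
    have hE₁'T : planar k E₁' ∈ T := by rw [hE₁', planar_vtx, mem_boxR_iff]; omega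
    have hne : E₁' ≠ E₂' := ne_of_planar_ne (by
      rw [hE₁', hE₂', planar_vtx, planar_vtx]; intro h; have := congrArg Prod.snd h; simp at this; omega)
    have had : planar k E₁' ≠ planar k w'' := by
      rw [hE₁', hw'', planar_vtx, planar_vtx]; intro h; have := congrArg Prod.snd h; simp at this; omega
    obtain ⟨L', Br', c, spec⟩ := exists_route hk (by omega) le_rfl hrows le_rfl hE₁'T hE₂'T hw''T hne had hbd
    have s3 := extend spec
    have hadj_E₁ : (slabGraph 3 k).Adj E₁ E₁' :=
      adj_of_cells (by rw [hE₁', ht_vtx_ht]) (by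
        rw [hE₁', planar_vtx, hE₁eq]; conv_lhs => rw [hxR]
        exact padj_l (xR - 1) rT)
    have hE₁T : planar k E₁ ∉ T := by rw [mem_boxR_iff]; omega
    refine ⟨_, _, _, RouteSpec.cons_trunk s3 (RP' := D) subset_rfl hadj_E₁ ?_ ?_ hE₁D⟩
    · intro h
      rcases List.mem_append.1 h with h | h
      · rcases List.mem_append.1 h with h | h
        · exact hE₁T (spec.hL_sub _ h)
        · exact hE₁d (List.mem_singleton.1 h)
      · exact hE₁a (by rw [List.mem_singleton.1 h, hE₂])
    · intro h
      rcases List.mem_append.1 h with h | h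
      · exact hE₁T (spec.hBr_sub _ h)
      · exact hE₁x (List.mem_singleton.1 h)
  · -- `E₁` inside the sub-box
    have hE₁T : planar k E₁ ∈ T := by rw [mem_boxR_iff] at hE₁D ⊢; omega
    have hne : E₁ ≠ E₂' := fun h => hE₁c (by rw [h, hE₂', planar_vtx])
    have had : planar k E₁ ≠ planar k w'' := by rw [hw'', planar_vtx]; exact hE₁b
    obtain ⟨L', Br', c, spec⟩ := exists_route hk (by omega) le_rfl hrows le_rfl hE₁T hE₂'T hw''T hne had hbd
    exact ⟨_, _, _, extend spec⟩

end BottomRight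

end NTW17

end Literature.Probability.Percolation

end
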